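import Mathlib
import HarnessLib
import Literature.Barriers.MatrixMultiplication.IrreversibilityBarrierProofs
import Summits.MatrixMultiplication.MatrixMultiplication.Theorems.OutsiderSandwichCouplingSubrankFull

/-!
# OutsiderSandwich — `CouplingDiagonal` holds: diagonals `⟨r⟩ ≤ C^{⊠N}` with `r ≥ 64^N 2^{-εN}` (decomp-mm lens-4, g17)

Closes item 28252 `CouplingDiagonal` of `Theses/OutsiderSandwich.lean` (the operational form of
`Q̃(C) = 64` for the coupling tensor `C = C₁ ⊠ C₂ ⊠ C₃` of `cw₂ ⊗ cw₂`):

* `exists_diagonal_of_le_asymptoticSubrank` — a general extraction lemma: if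
  `0 < c ≤ Q̃(t) = sup_N Q(t^{⊠N})^{1/N}`, then for every `ε > 0` and cofinally many `N` the power
  `t^{⊠N}` restricts to a diagonal `⟨r⟩` with `c^N ≤ r · 2^{εN}` (one good power from the supremum,
  then all its multiples by super-multiplicativity of the subrank,
  `Q(t^{⊠m})^k ≤ Q(t^{⊠km})`, tree `IrreversibilityBarrierProofs`).
* `couplingDiagonal_holds` — with `64 ≤ Q̃(C)`
  (`OutsiderSandwichCouplingSubrankFull.le_asymptoticSubrank_couplingTensor`: the laser value of the
  coupled CW block read on the spectrum, plus Strassen duality) this is `CouplingDiagonal`.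
* `couplingDiagonal_item` — item 28252 by name.
-/

noncomputable section

namespace Summit.MatrixMultiplication.MatrixMultiplication.Theorems.OutsiderSandwichCouplingDiagonal

open Literature.Computability.AlgebraicComplexity
open Literature.Barriers.MatrixMultiplication (restrictsTo_unitTensor_iff_le_subrank
  subrank_kroneckerPow_pow_le)
open Summit.MatrixMultiplication.MatrixMultiplication.Theorems.OutsiderSandwichCoupling
  (couplingTensor)

/-! ## 1. From a bound on the asymptotic subrank to cofinal diagonals -/

/-- **Extraction of diagonals from `Q̃`.** If `0 < c ≤ Q̃(t)`, then for every `ε > 0` and every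
`N₀` there is `N ≥ N₀` and a diagonal `⟨r⟩ ≤ t^{⊠N}` with `c^N ≤ r · 2^{εN}`. -/
theorem exists_diagonal_of_le_asymptoticSubrank {ι κ μ : Type} [Fintype ι] [Fintype κ]
    [Fintype μ] (t : ι → κ → μ → ℂ) {c : ℝ} (hc : 0 < c) (hct : c ≤ asymptoticSubrank ℂ t)
    {ε : ℝ} (hε : 0 < ε) (N₀ : ℕ) :
    ∃ N : ℕ, N₀ ≤ N ∧ ∃ r : ℕ, TensorRestrictsTo (kroneckerPow t N) (unitTensor ℂ r) ∧
      c ^ N ≤ (r : ℝ) * (2 : ℝ) ^ (ε * N) := by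
  classical
  -- Step 1: one power with a large diagonal, from the supremum defining `Q̃`.
  have h2ε : 0 < (2 : ℝ) ^ (-ε) := Real.rpow_pos_of_pos two_pos _
  have h2ε1 : (2 : ℝ) ^ (-ε) < 1 := Real.rpow_lt_one_of_one_lt_of_neg one_lt_two (by linarith)
  have hb0 : 0 ≤ c * (2 : ℝ) ^ (-ε) := (mul_pos hc h2ε).le
  have hlt : c * (2 : ℝ) ^ (-ε) < asymptoticSubrank ℂ t := by
    have : c * (2 : ℝ) ^ (-ε) < c := by nlinarith
    exact this.trans_le hct
  unfold asymptoticSubrank at hlt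
  obtain ⟨N₁, hN₁⟩ := exists_lt_of_lt_ciSup hlt
  set q : ℕ := subrank ℂ (kroneckerPow t (N₁ + 1)) with hq
  have hN₁' : c * (2 : ℝ) ^ (-ε) < (q : ℝ) ^ ((N₁ : ℝ) + 1)⁻¹ := hN₁
  have hq0 : (0 : ℝ) ≤ (q : ℝ) := Nat.cast_nonneg _
  have hroot : ((q : ℝ) ^ ((N₁ : ℝ) + 1)⁻¹) ^ (N₁ + 1) = (q : ℝ) := by
    rw [← Nat.cast_succ]
    exact Real.rpow_inv_natCast_pow hq0 (Nat.succ_ne_zero N₁)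
  have hpow : (c * (2 : ℝ) ^ (-ε)) ^ (N₁ + 1) ≤ (q : ℝ) := by
    rw [← hroot]
    exact pow_le_pow_left₀ hb0 hN₁'.le _
  -- Step 2: all multiples of that power, by super-multiplicativity of the subrank.
  refine ⟨(N₀ + 1) * (N₁ + 1), by nlinarith [Nat.zero_le (N₀ * N₁)], q ^ (N₀ + 1), ?_, ?_⟩
  · exact (restrictsTo_unitTensor_iff_le_subrank _ _).2
      (subrank_kroneckerPow_pow_le t (N₀ + 1) (N₁ + 1))
  · have h1 : (c * (2 : ℝ) ^ (-ε)) ^ ((N₀ + 1) * (N₁ + 1)) ≤ (q : ℝ) ^ (N₀ + 1) := by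
      rw [mul_comm (N₀ + 1) (N₁ + 1), pow_mul]
      exact pow_le_pow_left₀ (pow_nonneg hb0 _) hpow _
    have h2 : c ^ ((N₀ + 1) * (N₁ + 1)) =
        (c * (2 : ℝ) ^ (-ε)) ^ ((N₀ + 1) * (N₁ + 1)) *
          (2 : ℝ) ^ (ε * (((N₀ + 1) * (N₁ + 1) : ℕ) : ℝ)) := by
      rw [mul_pow, mul_assoc, ← Real.rpow_natCast ((2 : ℝ) ^ (-ε)) ((N₀ + 1) * (N₁ + 1)),
        ← Real.rpow_mul (by norm_num : (0 : ℝ) ≤ 2), ← Real.rpow_add two_pos]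
      have h0 : -ε * (((N₀ + 1) * (N₁ + 1) : ℕ) : ℝ) + ε * (((N₀ + 1) * (N₁ + 1) : ℕ) : ℝ) = 0 := by
        ring
      rw [h0, Real.rpow_zero, mul_one]
    rw [h2]
    push_cast
    exact mul_le_mul_of_nonneg_right h1 (Real.rpow_nonneg (by norm_num) _)

/-! ## 2. The coupling tensor -/

/-- **`CouplingDiagonal` holds**: for every `ε > 0` and cofinally many `N`, `C^{⊠N} ≥ ⟨r⟩` with
`64^N ≤ r · 2^{εN}` (from `64 ≤ Q̃(C)`). -/
theorem couplingDiagonal_holds : OutsiderSandwichCouplingSubrank.CouplingDiagonal := by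
  intro ε hε N₀
  exact exists_diagonal_of_le_asymptoticSubrank couplingTensor (by norm_num)
    OutsiderSandwichCouplingSubrankFull.le_asymptoticSubrank_couplingTensor hε N₀

/-- **Item 28252 `CouplingDiagonal` of `Theses/OutsiderSandwich.lean`, by name.** -/
theorem couplingDiagonal_item : Theses.OutsiderSandwich.CouplingDiagonal :=
  OutsiderSandwichCouplingSubrankItems.couplingDiagonal_iff.2 couplingDiagonal_holds

end Summit.MatrixMultiplication.MatrixMultiplication.Theorems.OutsiderSandwichCouplingDiagonal
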